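import Summits.BirchSwinnertonDyer.BirchSwinnertonDyer.Theorems.KimAtThreeFineKatoFinalCrux
import Summits.BirchSwinnertonDyer.BirchSwinnertonDyer.Theorems.KimAtThreeFineKatoPlaceChangeCharts
import Summits.BirchSwinnertonDyer.BirchSwinnertonDyer.Theorems.KimAtThreeFineKatoSATPointsRat
import HarnessLib

/-!
# The displayed hypothesis hKatoFin of `KimAtThreeFineKatoFinalCrux` (p531015) is DEGENERATE: its ∀-chart clause (C4')
# forces Kato's character sums — hence, by its own (C5), the twisted L-values times the cusp factors — to VANISH at every
# level with two places above 3 (crux `KatoKuriharaPortThreeShared`, stmt-BirchSwinnertonDyer-19560; cell `bsd-addord`,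
# seat w2-acc5 gen 7; route W2 `KimAtThreeKolyvagin`; `--supports 19560`, helper)

HONEST FRAMING.  Two theorems ABOUT A DISPLAYED HYPOTHESIS (no definition, no named fact, no instance, no `sorry`); the three
cite facts (P123) `cupLogInjective_and_hasDualExp_of_isDeRham`, (DR) `isDeRham_restrictedRationalTateRep`, (ND)
`nonempty_neronDeRhamDatum` are taken as hypotheses — CONDITIONAL on them.  Nothing is closed, nothing is booked; BSD /
19560 are NOT proved by this file; it proves NOTHING FALSE either: it derives consequences of `hFin` (the hypothesis text of
`KimAtThreeFineKatoFinalCrux.katoKuriharaPortThreeShared_of_facts_of_final`, BYTE-VERBATIM) which fail numerically on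
rank-0 rows of the stratum (w2-acc5 g7 kit job j282522: 2340f1, 6390q1, 6552x1, 7020o1, 8190w1, 8766x1 have `L(E,1) ≠ 0` and
`L(E^{(−11)},1) ≠ 0`), recording in the kernel WHY the residual of crux 19560 must bind `ι`, `x` WITH the chart (the LEAD's
hKatoPrintPos₀ / hKatoLitPos; `KimAtThreeFineKatoPlaceChange`, `KimAtThreeFineKatoPlaceChangeCharts`).

* `charSum_eq_zero_of_final` — under (P123), (DR), (ND) and `hFin`: for every stratum row, the `ι`, `κK` of `hFin` satisfy
  `κK ≠ 0`, R-κ, and for every auxiliary `(c, d, a, A)` the values `x` of `hFin` satisfy its (C5) AND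
  **`charSum m (ι m) χ (x k r) = 0` for every level `(k, r)`, every two places `w₀, w₁ ∣ 3` of `ℚ(ζ_m)` and every Dirichlet
  character `χ mod m` with `χ(c') ≠ 1` on the transporter `{c' : σ_{c'} • w₀ = w₁}`** (charts at `w₀` and at `w₁` exist by the
  cite facts — w2-acc4 `exists_twistFamily`, w2-c3 `hinj_hex_comp_of_facts`, w2-acc5 `exists_localNeronLine_res_single_of_neronDeRhamDatum`,
  `exists_padicTensorAlgEquiv` —, (C4') holds at both with the same `x k r`, and
  `KimAtThreeFineKatoPlaceChangeCharts.charSum_eq_zero_of_katoLambda_eq_one_tmul₂` applies; the class with `exp*_d ≠ 0` comes from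
  `hdual` on the stratum, kim3 `forall_norm_mul_padicLog_le_one_iff_three`).
* `depletedTwistedL_mul_cuspFactor_eq_zero_of_final` — hence, by (C5) and `κK ≠ 0`:
  **`L_S(f, χ, 1)/Ω⁺ · cuspFactor = 0` (even `χ`) and `L_S(f, χ, 1)/(i Ω⁻) · cuspFactor = 0` (odd `χ`)** for all such `χ` and all
  admissible `(d', Lχ)` — e.g. `m = 11` (`k = 0`, `r = {11}`, `11 ∤ 2cdAN`), `χ = (·/11)`, which is `≠ 1` exactly off the
  decomposition group `⟨3⟩`: a statement refuted numerically on the rows above.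

References: K. Kato, Astérisque 295 (2004) §9.4, Thm. 9.7, Thm. 6.6 (1) [Kato2004Asterisque]; J. W. S. Cassels, A. Fröhlich
(1967) Ch. II §10, Ch. VII §1.1 [CasselsFrohlichANT1967]; L. C. Washington (1997) Thm. 2.5 [Washington1997].
-/

noncomputable section

-- the cell's Theorems namespace `Summit.BirchSwinnertonDyer.BirchSwinnertonDyer.…` repeats the summit name by design (D-0017)
set_option linter.dupNamespace false

open scoped Classical NumberField TensorProduct ContRepresentation Pointwise
open Field ValuativeRel Function IsDedekindDomain NumberField
open WeierstrassCurve Literature.NumberTheory.EllipticCurves Literature.NumberTheory.GaloisRepresentations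
  Literature.NumberTheory.GaloisRepresentations.DiscreteGaloisModule Literature.NumberTheory.GaloisCohomology
open Literature.NumberTheory.GaloisRepresentations.PeriodRingData Literature.NumberTheory.PAdicHodge
open Literature.NumberTheory.EllipticCurves.ModularForms Literature.NumberTheory.EllipticCurves.Rank1Residual
open Literature.NumberTheory.EllipticCurves.Kato2004 Literature.NumberTheory.EllipticCurves.Kato2004.EulerSystemValues
open Literature.NumberTheory.AdelicBaseChange Literature.NumberTheory.Automorphic
open Summit.BirchSwinnertonDyer.Rank1Residual.GaloisImage
open Summit.BirchSwinnertonDyer.Rank1Residual.Additive.LocalLog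
open Summit.BirchSwinnertonDyer.BirchSwinnertonDyer.Theorems
open Summit.BirchSwinnertonDyer.BirchSwinnertonDyer.Theorems.KimAtThreeFineKatoPerFactorDefined
open Summit.BirchSwinnertonDyer.BirchSwinnertonDyer.Theorems.KimAtThreeDeepLowerExpStarOmega
open Summit.BirchSwinnertonDyer.BirchSwinnertonDyer.Theorems.KimAtThreeDeepLowerExpStarOmegaPlace
open Summit.BirchSwinnertonDyer.BirchSwinnertonDyer.Theorems.KimAtThreeFineKatoPerFactorPlaces
open Summit.BirchSwinnertonDyer.BirchSwinnertonDyer.Theorems.KimAtThreeFineKatoDefinedLambda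
open Summit.BirchSwinnertonDyer.BirchSwinnertonDyer.Theorems.KimAtThreeFineKatoTwistFamily
open Summit.BirchSwinnertonDyer.BirchSwinnertonDyer.Theorems.KimAtThreeFineKatoExpStarResSingle
open Summit.BirchSwinnertonDyer.BirchSwinnertonDyer.Theorems.KimAtThreeDeepUpperExpStarFactsTower
open Summit.BirchSwinnertonDyer.BirchSwinnertonDyer.Theorems.KimAtThreeFineKatoSATPointsRat
open Summit.BirchSwinnertonDyer.BirchSwinnertonDyer.Theorems.KimAtThreeFineKatoPlaceChangeCharts

namespace Summit.BirchSwinnertonDyer.BirchSwinnertonDyer.Theorems.KimAtThreeFineKatoFinalDegenerate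

set_option backward.isDefEq.respectTransparency false in
set_option maxHeartbeats 1600000 in
/-- **hKatoFin ⟹ Kato's character sums vanish off the transporter of two places** (module docstring, first bullet).  `hFin` is
the hypothesis of `KimAtThreeFineKatoFinalCrux.katoKuriharaPortThreeShared_of_facts_of_final` BYTE-VERBATIM; the three cite facts
supply the charts (`maxHeartbeats 1600000`: the 95-line hypothesis text plus two chart constructions in one proof).
[cite: Kato2004Asterisque, §9.4, Thm. 9.7 (p. 189) and Thm. 6.6 (1) (p. 163)] [cite: Kato1993LNM1553, Ch. II Prop. 1.2.3 and Ex. 1.3.5]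
[cite: CasselsFrohlichANT1967, Ch. II §10 Theorem (10.2) and Ch. VII §1.1] -/
theorem charSum_eq_zero_of_final (hP : cupLogInjective_and_hasDualExp_of_isDeRham)
    (hDR : isDeRham_restrictedRationalTateRep) (hND : nonempty_neronDeRhamDatum)
    (hFin : ∀ (W : WeierstrassCurve ℚ) [W.IsElliptic] [W.IsGloballyMinimal]
      [ContinuousSMul ℤ_[3] (W.tateModule 3)] [Module.Free ℤ_[3] (W.tateModule 3)]
      [Module.Finite ℤ_[3] (W.tateModule 3)],
      (∀ m : ℕ, W.HasSurjectiveModNGaloisRep (3 ^ m : ℕ)) →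
      (haveI : Fact (Nat.Prime 3) := ⟨Nat.prime_three⟩; Addv W 3) →
      ¬ 3 ∣ (W.baseChange ℚ_[3]).localTamagawaNumber ℤ_[3] →
      Nat.card {Q : (W.baseChange ℚ_[3]).toAffine.Point // (3 : ℕ) • Q = 0} = 1 →
      ∀ {N : ℕ} [NeZero N] (P : ModularParametrizationData W N), N = W.conductorNorm ℤ →
        (∀ z ∈ P.L.lattice, ∃ w ∈ periodLattice P.f, z = P.c * w) →
        ¬ (3 : ℤ) ∣ P.maninConstant →
        haveI : Fact (((3 : ℕ) : 𝓞 ℚ) ∈ ((Rat.HeightOneSpectrum.primesEquiv (R := 𝓞 ℚ)).symm ⟨3, Fact.out⟩).asIdeal) :=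
          ⟨(natCast_mem_asIdeal_iff_eq_primesEquiv_symm _ Nat.prime_three).mpr rfl⟩
        letI := valuativeRelPlace ((Rat.HeightOneSpectrum.primesEquiv (R := 𝓞 ℚ)).symm ⟨3, Fact.out⟩)
        letI := topologicalSpacePlace ((Rat.HeightOneSpectrum.primesEquiv (R := 𝓞 ℚ)).symm ⟨3, Fact.out⟩)
        haveI := isNonarchimedeanLocalField_place ((Rat.HeightOneSpectrum.primesEquiv (R := 𝓞 ℚ)).symm ⟨3, Fact.out⟩)
        haveI := charZero_place ((Rat.HeightOneSpectrum.primesEquiv (R := 𝓞 ℚ)).symm ⟨3, Fact.out⟩)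
        letI := padicAlgebraPlace 3 ((Rat.HeightOneSpectrum.primesEquiv (R := 𝓞 ℚ)).symm ⟨3, Fact.out⟩)
        haveI := fact_not_isUnit_place 3 ((Rat.HeightOneSpectrum.primesEquiv (R := 𝓞 ℚ)).symm ⟨3, Fact.out⟩)
        haveI := isAdicComplete_place 3 ((Rat.HeightOneSpectrum.primesEquiv (R := 𝓞 ℚ)).symm ⟨3, Fact.out⟩)
        ∃ (dv : LocalNeronLineAt W 3 ((Rat.HeightOneSpectrum.primesEquiv (R := 𝓞 ℚ)).symm ⟨3, Fact.out⟩))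
          (hinj : (bdRPeriodRingData (valuation_place_lt_one 3 ((Rat.HeightOneSpectrum.primesEquiv (R := 𝓞 ℚ)).symm ⟨3, Fact.out⟩))).CupLogInjective (logCyclotomic 3)
            (localRationalTateRep W 3 (galRestrictPlace ((Rat.HeightOneSpectrum.primesEquiv (R := 𝓞 ℚ)).symm ⟨3, Fact.out⟩))))
          (hex : ∀ z : contOneCocycles (localRationalTateRep W 3 (galRestrictPlace ((Rat.HeightOneSpectrum.primesEquiv (R := 𝓞 ℚ)).symm ⟨3, Fact.out⟩))).toTopRep,
            (bdRPeriodRingData (valuation_place_lt_one 3 ((Rat.HeightOneSpectrum.primesEquiv (R := 𝓞 ℚ)).symm ⟨3, Fact.out⟩))).HasDualExp (logCyclotomic 3)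
              (localRationalTateRep W 3 (galRestrictPlace ((Rat.HeightOneSpectrum.primesEquiv (R := 𝓞 ℚ)).symm ⟨3, Fact.out⟩))) fun σ => z.1 σ),
          (∀ a : ℚ_[3], (∃ y, (expStarOmegaPadicAt dv hinj hex (((Padic.adicCompletionEquiv (𝓞 ℚ) ⟨3, Fact.out⟩).symm : (((Rat.HeightOneSpectrum.primesEquiv (R := 𝓞 ℚ)).symm ⟨3, Fact.out⟩).adicCompletion ℚ) →+* ℚ_[3]))) y = a) ↔
            ∀ Q : (W.baseChange ℚ_[3]).toAffine.Point, ‖a * padicLog (W.baseChange ℚ_[3]) Q‖ ≤ 1) ∧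
        ∃ (ι : (n : ℕ) → (CyclotomicField n ℚ →+* ℂ)) (κK : ℝ),
          κK ≠ 0 ∧ (∃ u : ℚ, (u : ℝ) = κK ∧ padicValRat 3 u = 0) ∧
          ∀ (c d a : ℤ) (A : ℕ), 0 < A → Int.gcd c (6 * 3 * A) = 1 → Int.gcd d (6 * 3 * N) = 1 →
            ∃ (z : ∀ (k' : ℕ) (r : (cyclotomicLevelsRat 3 (badPlaces c d A N)).Ideals),
                  H1 (tateRep W 3) ((cyclotomicLevelsRat 3 (badPlaces c d A N)).level k' r.1))
              (x : ∀ (k' : ℕ) (r : (cyclotomicLevelsRat 3 (badPlaces c d A N)).Ideals),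
                  CyclotomicField (cycLevel 3 k' r.1) ℚ),
              IsEulerSystem (cyclotomicLevelsRat 3 (badPlaces c d A N)) (tateRep W 3) 3 z ∧
              (∀ (k : ℕ) (r : (cyclotomicLevelsRat 3 (badPlaces c d A N)).Ideals) (v : HeightOneSpectrum (𝓞 ℚ)), ((Rat.HeightOneSpectrum.primesEquiv v : Nat.Primes) : ℕ) ≠ 3 →
                  ∀ 𝔓 ∈ v.primesAbove,
                    resLe (tateRep W 3).toTopRep
                        (inf_le_left : (cyclotomicLevelsRat 3 (badPlaces c d A N)).level k r.1 ⊓ 𝔓.inertia (absoluteGaloisGroup ℚ) ≤ (cyclotomicLevelsRat 3 (badPlaces c d A N)).level k r.1)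
                        1 (z k r) = 0) ∧
              (∀ (k : ℕ) (r : (cyclotomicLevelsRat 3 (badPlaces c d A N)).Ideals)
              (Ψ : ℚ_[3] ⊗[ℚ] CyclotomicField (cycLevel 3 k r.1) ℚ ≃ₐ[ℚ]
                (Π w : ((Rat.HeightOneSpectrum.primesEquiv (R := 𝓞 ℚ)).symm ⟨3, Fact.out⟩).Extension
                  (𝓞 (CyclotomicField (cycLevel 3 k r.1) ℚ)), w.1.adicCompletion (CyclotomicField (cycLevel 3 k r.1) ℚ)))
              (hΨ : ∀ (s : ℚ_[3]) (x : CyclotomicField (cycLevel 3 k r.1) ℚ)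
                (w : ((Rat.HeightOneSpectrum.primesEquiv (R := 𝓞 ℚ)).symm ⟨3, Fact.out⟩).Extension
                  (𝓞 (CyclotomicField (cycLevel 3 k r.1) ℚ))),
                Ψ (s ⊗ₜ[ℚ] x) w =
                  algebraMap (CyclotomicField (cycLevel 3 k r.1) ℚ) (w.1.adicCompletion (CyclotomicField (cycLevel 3 k r.1) ℚ)) x *
                  algebraMap (((Rat.HeightOneSpectrum.primesEquiv (R := 𝓞 ℚ)).symm ⟨3, Fact.out⟩).adicCompletion ℚ)
                    (w.1.adicCompletion (CyclotomicField (cycLevel 3 k r.1) ℚ)) ((Padic.adicCompletionEquiv (𝓞 ℚ) ⟨3, Fact.out⟩) s))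
              (w₀ : ((Rat.HeightOneSpectrum.primesEquiv (R := 𝓞 ℚ)).symm ⟨3, Fact.out⟩).Extension
                  (𝓞 (CyclotomicField (cycLevel 3 k r.1) ℚ)))
                (g : ((Rat.HeightOneSpectrum.primesEquiv (R := 𝓞 ℚ)).symm ⟨3, Fact.out⟩).Extension
                  (𝓞 (CyclotomicField (cycLevel 3 k r.1) ℚ)) → absoluteGaloisGroup ℚ)
                (hg : ∀ w : ((Rat.HeightOneSpectrum.primesEquiv (R := 𝓞 ℚ)).symm ⟨3, Fact.out⟩).Extension
                  (𝓞 (CyclotomicField (cycLevel 3 k r.1) ℚ)),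
                  sigma (cycLevel 3 k r.1) (modNCyclotomicCharacter ℚ (cycLevel 3 k r.1) (g w)) • w.1 = w₀.1),
                  letI := LocalField.charZero_adicCompletion w₀.1
                  letI := LocalField.adicCompletionPadicAlgebra w₀.1 3 (three_mem_asIdeal_extension _ w₀)
                  haveI : Fact (¬ IsUnit ((3 : ℕ) : integerC (w₀.1.adicCompletion (CyclotomicField (cycLevel 3 k r.1) ℚ)))) :=
                    ⟨not_isUnit_natCast_integerC (LocalField.valuation_adicCompletion_natCast_lt_one w₀.1 3 (three_mem_asIdeal_extension _ w₀))⟩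
                  haveI := isAdicComplete_integerC_natCast (LocalField.valuation_adicCompletion_natCast_lt_one w₀.1 3 (three_mem_asIdeal_extension _ w₀))
                  ∀ (dw : LocalNeronLine W (LocalField.valuation_adicCompletion_natCast_lt_one w₀.1 3 (three_mem_asIdeal_extension _ w₀))
                    ((galRestrictPlace ((Rat.HeightOneSpectrum.primesEquiv (R := 𝓞 ℚ)).symm ⟨3, Fact.out⟩)).comp
                      (absGaloisRestrict (((Rat.HeightOneSpectrum.primesEquiv (R := 𝓞 ℚ)).symm ⟨3, Fact.out⟩).adicCompletion ℚ) (w₀.1.adicCompletion (CyclotomicField (cycLevel 3 k r.1) ℚ)))))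
                    (hinjw : (bdRPeriodRingData (LocalField.valuation_adicCompletion_natCast_lt_one w₀.1 3 (three_mem_asIdeal_extension _ w₀))).CupLogInjective
                    (logCyclotomic 3) (localRationalTateRep W 3 ((galRestrictPlace ((Rat.HeightOneSpectrum.primesEquiv (R := 𝓞 ℚ)).symm ⟨3, Fact.out⟩)).comp
                      (absGaloisRestrict (((Rat.HeightOneSpectrum.primesEquiv (R := 𝓞 ℚ)).symm ⟨3, Fact.out⟩).adicCompletion ℚ) (w₀.1.adicCompletion (CyclotomicField (cycLevel 3 k r.1) ℚ))))))
                    (hexw : ∀ z : contOneCocycles (localRationalTateRep W 3 ((galRestrictPlace ((Rat.HeightOneSpectrum.primesEquiv (R := 𝓞 ℚ)).symm ⟨3, Fact.out⟩)).comp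
                      (absGaloisRestrict (((Rat.HeightOneSpectrum.primesEquiv (R := 𝓞 ℚ)).symm ⟨3, Fact.out⟩).adicCompletion ℚ) (w₀.1.adicCompletion (CyclotomicField (cycLevel 3 k r.1) ℚ))))).toTopRep,
                    (bdRPeriodRingData (LocalField.valuation_adicCompletion_natCast_lt_one w₀.1 3 (three_mem_asIdeal_extension _ w₀))).HasDualExp
                      (logCyclotomic 3) (localRationalTateRep W 3 ((galRestrictPlace ((Rat.HeightOneSpectrum.primesEquiv (R := 𝓞 ℚ)).symm ⟨3, Fact.out⟩)).comp
                      (absGaloisRestrict (((Rat.HeightOneSpectrum.primesEquiv (R := 𝓞 ℚ)).symm ⟨3, Fact.out⟩).adicCompletion ℚ) (w₀.1.adicCompletion (CyclotomicField (cycLevel 3 k r.1) ℚ))))) fun σ => z.1 σ),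
                    (∀ (h : (tateLocalRep W 3 (Sum.inr ((Rat.HeightOneSpectrum.primesEquiv (R := 𝓞 ℚ)).symm ⟨3, Fact.out⟩))).cohomology 1),
                    (expStarOmegaHom (LocalField.valuation_adicCompletion_natCast_lt_one w₀.1 3 (three_mem_asIdeal_extension _ w₀))
                      ((galRestrictPlace ((Rat.HeightOneSpectrum.primesEquiv (R := 𝓞 ℚ)).symm ⟨3, Fact.out⟩)).comp
                      (absGaloisRestrict (((Rat.HeightOneSpectrum.primesEquiv (R := 𝓞 ℚ)).symm ⟨3, Fact.out⟩).adicCompletion ℚ) (w₀.1.adicCompletion (CyclotomicField (cycLevel 3 k r.1) ℚ)))) dw hinjw hexw)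
                      (ContinuousRep.cohomologyRes (tateLocalRep W 3 (Sum.inr ((Rat.HeightOneSpectrum.primesEquiv (R := 𝓞 ℚ)).symm ⟨3, Fact.out⟩)))
                        (absGaloisRestrict (((Rat.HeightOneSpectrum.primesEquiv (R := 𝓞 ℚ)).symm ⟨3, Fact.out⟩).adicCompletion ℚ) (w₀.1.adicCompletion (CyclotomicField (cycLevel 3 k r.1) ℚ))) 1 h) =
                    algebraMap (((Rat.HeightOneSpectrum.primesEquiv (R := 𝓞 ℚ)).symm ⟨3, Fact.out⟩).adicCompletion ℚ) (w₀.1.adicCompletion (CyclotomicField (cycLevel 3 k r.1) ℚ)) (expStarOmegaAt dv h)) →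
                    katoLambda W 3 k r.1 w₀ Ψ hΨ (three_mem_asIdeal_extension _ w₀) g hg dw hinjw hexw (z k r) =
                      (1 : ℚ_[3]) ⊗ₜ[ℚ] x k r) ∧
              (∀ (k : ℕ) (r : (cyclotomicLevelsRat 3 (badPlaces c d A N)).Ideals) (d' : ℤ) (χ : DirichletCharacter ℂ (cycLevel 3 k r.1)) (Lχ : ℂ → ℂ),
                  Int.gcd (c * d) (cycLevel 3 k r.1 * A) = 1 →
                  d * d' ≡ 1 [ZMOD (A : ℤ)] →
                  IsDepletedTwistedL P.f (cycLevel 3 k r.1) ((3 : ℕ) * A) χ Lχ →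
                    (χ (-1) = 1 →
                      charSum (cycLevel 3 k r.1) (ι (cycLevel 3 k r.1)) χ (x k r) =
                        (κK : ℂ) * (Lχ 1 / (plusPeriod P.f : ℂ)) *
                          cuspFactor P.f true (fun n ↦ χ⁻¹ (n : ZMod (cycLevel 3 k r.1))) c d a A d') ∧
                    (χ (-1) = -1 →
                      charSum (cycLevel 3 k r.1) (ι (cycLevel 3 k r.1)) χ (x k r) =
                        -(κK : ℂ) * (Lχ 1 / (Complex.I * (minusPeriod P.f : ℂ))) *
                          cuspFactor P.f false (fun n ↦ χ⁻¹ (n : ZMod (cycLevel 3 k r.1))) c d a A d'))) :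
    ∀ (W : WeierstrassCurve ℚ) [W.IsElliptic] [W.IsGloballyMinimal]
      [ContinuousSMul ℤ_[3] (W.tateModule 3)] [Module.Free ℤ_[3] (W.tateModule 3)]
      [Module.Finite ℤ_[3] (W.tateModule 3)],
      (∀ m : ℕ, W.HasSurjectiveModNGaloisRep (3 ^ m : ℕ)) →
      (haveI : Fact (Nat.Prime 3) := ⟨Nat.prime_three⟩; Addv W 3) →
      ¬ 3 ∣ (W.baseChange ℚ_[3]).localTamagawaNumber ℤ_[3] →
      Nat.card {Q : (W.baseChange ℚ_[3]).toAffine.Point // (3 : ℕ) • Q = 0} = 1 →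
      ∀ {N : ℕ} [NeZero N] (P : ModularParametrizationData W N), N = W.conductorNorm ℤ →
        (∀ z ∈ P.L.lattice, ∃ w ∈ periodLattice P.f, z = P.c * w) →
        ¬ (3 : ℤ) ∣ P.maninConstant →
        ∃ (ι : (n : ℕ) → (CyclotomicField n ℚ →+* ℂ)) (κK : ℝ),
          κK ≠ 0 ∧ (∃ u : ℚ, (u : ℝ) = κK ∧ padicValRat 3 u = 0) ∧
          ∀ (c d a : ℤ) (A : ℕ), 0 < A → Int.gcd c (6 * 3 * A) = 1 → Int.gcd d (6 * 3 * N) = 1 →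
            ∃ (x : ∀ (k' : ℕ) (r : (cyclotomicLevelsRat 3 (badPlaces c d A N)).Ideals),
                  CyclotomicField (cycLevel 3 k' r.1) ℚ),
              (∀ (k : ℕ) (r : (cyclotomicLevelsRat 3 (badPlaces c d A N)).Ideals) (d' : ℤ) (χ : DirichletCharacter ℂ (cycLevel 3 k r.1)) (Lχ : ℂ → ℂ),
                  Int.gcd (c * d) (cycLevel 3 k r.1 * A) = 1 →
                  d * d' ≡ 1 [ZMOD (A : ℤ)] →
                  IsDepletedTwistedL P.f (cycLevel 3 k r.1) ((3 : ℕ) * A) χ Lχ →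
                    (χ (-1) = 1 →
                      charSum (cycLevel 3 k r.1) (ι (cycLevel 3 k r.1)) χ (x k r) =
                        (κK : ℂ) * (Lχ 1 / (plusPeriod P.f : ℂ)) *
                          cuspFactor P.f true (fun n ↦ χ⁻¹ (n : ZMod (cycLevel 3 k r.1))) c d a A d') ∧
                    (χ (-1) = -1 →
                      charSum (cycLevel 3 k r.1) (ι (cycLevel 3 k r.1)) χ (x k r) =
                        -(κK : ℂ) * (Lχ 1 / (Complex.I * (minusPeriod P.f : ℂ))) *
                          cuspFactor P.f false (fun n ↦ χ⁻¹ (n : ZMod (cycLevel 3 k r.1))) c d a A d')) ∧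
              ∀ (k : ℕ) (r : (cyclotomicLevelsRat 3 (badPlaces c d A N)).Ideals)
                (w₀ w₁ : ((Rat.HeightOneSpectrum.primesEquiv (R := 𝓞 ℚ)).symm ⟨3, Fact.out⟩).Extension (𝓞 (CyclotomicField (cycLevel 3 k r.1) ℚ)))
                (χ : DirichletCharacter ℂ (cycLevel 3 k r.1)),
                (∀ c' : (ZMod (cycLevel 3 k r.1))ˣ, sigma (cycLevel 3 k r.1) c' • w₀.1 = w₁.1 →
                  χ (c' : ZMod (cycLevel 3 k r.1)) ≠ 1) →
                charSum (cycLevel 3 k r.1) (ι (cycLevel 3 k r.1)) χ (x k r) = 0 := by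
  intro W _ _ _ _ _ htow hadd hc ht N _ P hN hL hM
  haveI : Fact (((3 : ℕ) : 𝓞 ℚ) ∈ ((Rat.HeightOneSpectrum.primesEquiv (R := 𝓞 ℚ)).symm ⟨3, Fact.out⟩).asIdeal) := ⟨(natCast_mem_asIdeal_iff_eq_primesEquiv_symm _ Nat.prime_three).mpr rfl⟩
  letI := valuativeRelPlace ((Rat.HeightOneSpectrum.primesEquiv (R := 𝓞 ℚ)).symm ⟨3, Fact.out⟩)
  letI := topologicalSpacePlace ((Rat.HeightOneSpectrum.primesEquiv (R := 𝓞 ℚ)).symm ⟨3, Fact.out⟩)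
  haveI := isNonarchimedeanLocalField_place ((Rat.HeightOneSpectrum.primesEquiv (R := 𝓞 ℚ)).symm ⟨3, Fact.out⟩)
  haveI := charZero_place ((Rat.HeightOneSpectrum.primesEquiv (R := 𝓞 ℚ)).symm ⟨3, Fact.out⟩)
  letI := padicAlgebraPlace 3 ((Rat.HeightOneSpectrum.primesEquiv (R := 𝓞 ℚ)).symm ⟨3, Fact.out⟩)
  haveI := fact_not_isUnit_place 3 ((Rat.HeightOneSpectrum.primesEquiv (R := 𝓞 ℚ)).symm ⟨3, Fact.out⟩)
  haveI := isAdicComplete_place 3 ((Rat.HeightOneSpectrum.primesEquiv (R := 𝓞 ℚ)).symm ⟨3, Fact.out⟩)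
  obtain ⟨dv, hinj, hex, hdual, ι, κK, hκ, hR, hall⟩ := hFin W htow hadd hc ht P hN hL hM
  refine ⟨ι, κK, hκ, hR, fun c d a A hA hcA hdN => ?_⟩
  obtain ⟨z, x, -, -, hC4, hC5⟩ := hall c d a A hA hcA hdN
  refine ⟨x, hC5, fun k r w₀ w₁ χ hχ => ?_⟩
  -- one class with `exp*_{dv} ≠ 0`: `exp*_{dv}` reaches `1` (dual lattice `= ℤ₃` on the stratum)
  obtain ⟨y₁, hy₁⟩ := (hdual 1).2 ((forall_norm_mul_padicLog_le_one_iff_three W hadd hc ht 1).2 norm_one.le)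
  have hne : ∃ y, expStarOmegaAt dv y ≠ 0 := by
    refine ⟨y₁, fun h0 => ?_⟩
    rw [expStarOmegaPadicAt_apply] at hy₁
    exact one_ne_zero (hy₁.symm.trans (by rw [show expStarOmegaAt dv y₁ = 0 from h0, map_zero]))
  -- the charts at `w₀` and at `w₁`: `Ψ` (Cassels–Fröhlich), twist families (transitivity), Prop-1.2.3 binders ((P123)+(DR)),
  -- line data with (RES₀) ((ND))
  have hΨex := exists_padicTensorAlgEquiv (CyclotomicField (cycLevel 3 k r.1) ℚ) 3
  obtain ⟨Ψ, hΨ⟩ := hΨex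
  have hg₀ex := exists_twistFamily (cycLevel 3 k r.1) ((Rat.HeightOneSpectrum.primesEquiv (R := 𝓞 ℚ)).symm ⟨3, Fact.out⟩) w₀
  obtain ⟨g₀, hg₀⟩ := hg₀ex
  have hg₁ex := exists_twistFamily (cycLevel 3 k r.1) ((Rat.HeightOneSpectrum.primesEquiv (R := 𝓞 ℚ)).symm ⟨3, Fact.out⟩) w₁
  obtain ⟨g₁, hg₁⟩ := hg₁ex
  have hPw : ∀ w : ((Rat.HeightOneSpectrum.primesEquiv (R := 𝓞 ℚ)).symm ⟨3, Fact.out⟩).Extension (𝓞 (CyclotomicField (cycLevel 3 k r.1) ℚ)),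
      letI := LocalField.charZero_adicCompletion w.1
      letI := LocalField.adicCompletionPadicAlgebra w.1 3 (three_mem_asIdeal_extension _ w)
      haveI : Fact (¬ IsUnit ((3 : ℕ) : integerC (w.1.adicCompletion (CyclotomicField (cycLevel 3 k r.1) ℚ)))) := ⟨not_isUnit_natCast_integerC (LocalField.valuation_adicCompletion_natCast_lt_one w.1 3 (three_mem_asIdeal_extension _ w))⟩
      haveI := isAdicComplete_integerC_natCast (LocalField.valuation_adicCompletion_natCast_lt_one w.1 3 (three_mem_asIdeal_extension _ w))
      (bdRPeriodRingData (LocalField.valuation_adicCompletion_natCast_lt_one w.1 3 (three_mem_asIdeal_extension _ w))).CupLogInjective (logCyclotomic 3) (localRationalTateRep W 3 ((galRestrictPlace ((Rat.HeightOneSpectrum.primesEquiv (R := 𝓞 ℚ)).symm ⟨3, Fact.out⟩)).comp (absGaloisRestrict (((Rat.HeightOneSpectrum.primesEquiv (R := 𝓞 ℚ)).symm ⟨3, Fact.out⟩).adicCompletion ℚ) (w.1.adicCompletion (CyclotomicField (cycLevel 3 k r.1) ℚ))))) ∧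
        ∀ z : contOneCocycles (localRationalTateRep W 3 ((galRestrictPlace ((Rat.HeightOneSpectrum.primesEquiv (R := 𝓞 ℚ)).symm ⟨3, Fact.out⟩)).comp (absGaloisRestrict (((Rat.HeightOneSpectrum.primesEquiv (R := 𝓞 ℚ)).symm ⟨3, Fact.out⟩).adicCompletion ℚ) (w.1.adicCompletion (CyclotomicField (cycLevel 3 k r.1) ℚ))))).toTopRep,
          (bdRPeriodRingData (LocalField.valuation_adicCompletion_natCast_lt_one w.1 3 (three_mem_asIdeal_extension _ w))).HasDualExp (logCyclotomic 3) (localRationalTateRep W 3 ((galRestrictPlace ((Rat.HeightOneSpectrum.primesEquiv (R := 𝓞 ℚ)).symm ⟨3, Fact.out⟩)).comp (absGaloisRestrict (((Rat.HeightOneSpectrum.primesEquiv (R := 𝓞 ℚ)).symm ⟨3, Fact.out⟩).adicCompletion ℚ) (w.1.adicCompletion (CyclotomicField (cycLevel 3 k r.1) ℚ))))) fun σ => z.1 σ := by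
    intro w
    letI := LocalField.charZero_adicCompletion w.1
    letI : Algebra (Place.Completion (K := ℚ) (Sum.inr ((Rat.HeightOneSpectrum.primesEquiv (R := 𝓞 ℚ)).symm ⟨3, Fact.out⟩))) (w.1.adicCompletion (CyclotomicField (cycLevel 3 k r.1) ℚ)) :=
      inferInstanceAs (Algebra (((Rat.HeightOneSpectrum.primesEquiv (R := 𝓞 ℚ)).symm ⟨3, Fact.out⟩).adicCompletion ℚ) (w.1.adicCompletion (CyclotomicField (cycLevel 3 k r.1) ℚ)))
    haveI : Fact (¬ IsUnit ((3 : ℕ) : integerC (w.1.adicCompletion (CyclotomicField (cycLevel 3 k r.1) ℚ)))) := ⟨not_isUnit_natCast_integerC (LocalField.valuation_adicCompletion_natCast_lt_one w.1 3 (three_mem_asIdeal_extension _ w))⟩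
    haveI := isAdicComplete_integerC_natCast (LocalField.valuation_adicCompletion_natCast_lt_one w.1 3 (three_mem_asIdeal_extension _ w))
    have hcont : Continuous (algebraMap (Place.Completion (K := ℚ) (Sum.inr ((Rat.HeightOneSpectrum.primesEquiv (R := 𝓞 ℚ)).symm ⟨3, Fact.out⟩))) (w.1.adicCompletion (CyclotomicField (cycLevel 3 k r.1) ℚ))) :=
      continuous_algebraMap (((Rat.HeightOneSpectrum.primesEquiv (R := 𝓞 ℚ)).symm ⟨3, Fact.out⟩).adicCompletion ℚ) (w.1.adicCompletion (CyclotomicField (cycLevel 3 k r.1) ℚ))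
    exact hinj_hex_comp_of_facts W 3 ((Rat.HeightOneSpectrum.primesEquiv (R := 𝓞 ℚ)).symm ⟨3, Fact.out⟩) (L := (w.1.adicCompletion (CyclotomicField (cycLevel 3 k r.1) ℚ))) (LocalField.valuation_adicCompletion_natCast_lt_one w.1 3 (three_mem_asIdeal_extension _ w)) hP hDR hcont
  have hdw₀ex := exists_localNeronLine_res_single_of_neronDeRhamDatum W 3 (CyclotomicField (cycLevel 3 k r.1) ℚ) w₀
    ((natCast_mem_asIdeal_iff_eq_primesEquiv_symm _ Nat.prime_three).mpr rfl) (three_mem_asIdeal_extension _ w₀) hND dv hinj hex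
  obtain ⟨dw₀, hres₀⟩ := hdw₀ex
  have hdw₁ex := exists_localNeronLine_res_single_of_neronDeRhamDatum W 3 (CyclotomicField (cycLevel 3 k r.1) ℚ) w₁
    ((natCast_mem_asIdeal_iff_eq_primesEquiv_symm _ Nat.prime_three).mpr rfl) (three_mem_asIdeal_extension _ w₁) hND dv hinj hex
  obtain ⟨dw₁, hres₁⟩ := hdw₁ex
  -- (C4') at both charts, SAME `x k r`
  have h4₀ := hC4 k r Ψ hΨ w₀ g₀ hg₀ dw₀ (hPw w₀).1 (hPw w₀).2 (fun h => hres₀ (hPw w₀).1 (hPw w₀).2 h)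
  have h4₁ := hC4 k r Ψ hΨ w₁ g₁ hg₁ dw₁ (hPw w₁).1 (hPw w₁).2 (fun h => hres₁ (hPw w₁).1 (hPw w₁).2 h)
  exact charSum_eq_zero_of_katoLambda_eq_one_tmul₂ W 3 k r.1 Ψ hΨ w₀ w₁ (three_mem_asIdeal_extension _ w₀)
    (three_mem_asIdeal_extension _ w₁) g₀ hg₀ g₁ hg₁ dv hinj hex hne
    dw₀ (hPw w₀).1 (hPw w₀).2 (fun h => hres₀ (hPw w₀).1 (hPw w₀).2 h)
    dw₁ (hPw w₁).1 (hPw w₁).2 (fun h => hres₁ (hPw w₁).1 (hPw w₁).2 h)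
    (z k r) (x k r) h4₀ h4₁ (ι (cycLevel 3 k r.1)) χ hχ

end Summit.BirchSwinnertonDyer.BirchSwinnertonDyer.Theorems.KimAtThreeFineKatoFinalDegenerate

end
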